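import Summits.Ventures.WeilGRH.TwistedGramCellConsts
import Summits.Ventures.WeilGRH.TwistedGramCellSigns
import Summits.Ventures.WeilGRH.TwistedGramCellSignsOddArctan
import HarnessLib

/-!
# GRH arm (rh-explicit, venture WeilGRH): twisted format-C cell kit — sign facts with a GENERIC prime constant and the box of
  the character-weighted constant `A_χ(a)`

Cell `rh-explicit`, WEIL TRACK — GRH ARM (engine seat weil-grh-2 gen13).  Kernel side of the character-weighted door
`weilPositivityOnChar_of_twisted_formatC_dataAW` (`TwistedDataRungAW.lean`): the sign checkers `checkSignsE` / `checkSignsOA`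
are UNCHANGED (they read the prime constant only through the box `d.AOP`); this file (i) restates their soundness theorems for an
ARBITRARY real `Aop ∈ d.AOP` (`signsE_of_checkSignsE_A`, `signsO_of_checkSignsOA_A` — proofs verbatim), and (ii) supplies the box
`aopBoxW … εs ∋ A_χ(a) = Σ_k |Re χ(k)|·Λ(k)k^{-1/2}·2cos(π/(⌊2a/log k⌋+2))` for a real character with integer prime signs
`ε_i = Re χ(k_i)` (`mem_aopBoxW`).  Computable `def`s with docstrings; RH/GRH-free; standard axioms.
References: H. Yoshida (1992) §7 [Yoshida1992HermitianForms]; R. E. Moore (1966) Ch. 3 [Moore1966].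
-/

set_option autoImplicit false
set_option linter.style.longLine false

open Real Complex Finset
open scoped BigOperators ArithmeticFunction.vonMangoldt

namespace Summit.Ventures.WeilGRH

open Literature.NumberTheory.LFunctions Literature.NumberTheory.LFunctions.Yoshida1992
open Literature.NumberTheory.LFunctions.Yoshida1992.Encl
open Literature.Analysis.SpecialFunctions Literature.Analysis.ValidatedNumerics.NumericsMP

namespace TwistedEncl

variable {S : ℕ} {a : ℝ} {q : ℕ}

/-! ## The box of `A_χ(a)` -/

/-- `Σ_{i<m} |ε_i|·wts_i·2·Re e^{iπ/(n_i+2)}` — partial sums of the character-weighted prime constant `A_χ`. [cite: Yoshida1992HermitianForms, §7 pp. 305–312] -/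
def aopSumW (S K k : ℕ) (C : Consts) (ns : List ℕ) (εs : List ℤ) : ℕ → Option MI
  | 0 => some (MI.ofInt S 0)
  | i + 1 =>
    match aopSumW S K k C ns εs i, MC.expI S K k C.P (C.P.divNat (ns.getD i 0 + 2)) with
    | some acc, some Z => some (acc.add (((C.wts.getD i default).mul S Z.re).mulInt (2 * ((εs.getD i 0).natAbs : ℤ))))
    | _, _ => none

/-- Box of `A_χ(a) = Σ_k |Re χ(k)|·Λ(k)k^{-1/2}·2cos(π/(n_k+2))` (prime signs `εs`, floors `ns`). [cite: Yoshida1992HermitianForms, §7 pp. 305–312] -/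
def aopBoxW (S K k : ℕ) (C : Consts) (ns : List ℕ) (εs : List ℤ) : Option MI := aopSumW S K k C ns εs C.wts.length

/-- Soundness of `aopSumW`. [cite: Moore1966, Ch. 3 (interval arithmetic: inclusion property)] -/
theorem mem_aopSumW (hS : 0 < S) {ks : List PrimeLen} {C : Consts} (hC : ConstsValid S a ks C) {K k : ℕ} (ns : List ℕ)
    (εs : List ℤ) :
    ∀ i, i ≤ ks.length → ∀ {Y : MI}, aopSumW S K k C ns εs i = some Y →
      MI.mem S (∑ j ∈ Finset.range i, |((εs.getD j 0 : ℤ) : ℝ)| *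
        ((ks.getD j default).wt * (2 * Real.cos (π / ((ns.getD j 0 : ℕ) + 2))))) Y
  | 0, _, Y, h => by
      simp only [aopSumW, Option.some.injEq] at h
      subst h
      simpa using MI.mem_ofInt S 0
  | i + 1, hi, Y, h => by
      simp only [aopSumW] at h
      split at h
      · rename_i acc Z hacc hZ
        simp only [Option.some.injEq] at h
        subst h
        rw [Finset.sum_range_succ]
        have hrec := mem_aopSumW hS hC ns εs i (by omega) hacc
        have hθ : MI.mem S (π / ((ns.getD i 0 : ℕ) + 2 : ℕ)) (C.P.divNat (ns.getD i 0 + 2)) :=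
          MI.mem_divNat hC.pi (by omega)
        have hZm := (MC.mem_expI hS hC.pi hZ hθ).1
        rw [Complex.exp_ofReal_mul_I_re] at hZm
        refine MI.mem_add hrec (mem_of_eq (MI.mem_mulInt (MI.mem_mul hS (hC.wts i hi) hZm) (2 * ((εs.getD i 0).natAbs : ℤ))) ?_)
        rw [Int.cast_mul, Int.cast_natCast, Nat.cast_natAbs, Int.cast_abs]
        push_cast
        ring
      · simp at h

/-- ★ **Soundness of `aopBoxW`**: floors checked and prime signs `Re χ(k_i) = ε_i` ⇒ `A_χ(a) ∈ AOPW`. [cite: Yoshida1992HermitianForms, §7 pp. 305–312] -/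
theorem mem_aopBoxW (hS : 0 < S) (ha0 : 0 < a) {ks : List PrimeLen} (hks : PrimeData a ks) {C : Consts}
    (hC : ConstsValid S a ks C) (χ : DirichletCharacter ℂ q) {εs : List ℤ}
    (hε : ∀ i < ks.length, (χ (((ks.getD i default).val : ℕ) : ZMod q)).re = ((εs.getD i 0 : ℤ) : ℝ))
    {K k : ℕ} {ns : List ℕ} (hfl : TwistedEncl.checkFloors C ns = true) {AOPW : MI}
    (h : aopBoxW S K k C ns εs = some AOPW) :
    MI.mem S (∑ j ∈ weilPrimeIndex a, |(χ (j : ZMod q)).re| *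
      ((Λ j : ℝ) / Real.sqrt j * (2 * Real.cos (π / (⌊2 * a / Real.log j⌋₊ + 2))))) AOPW := by
  have hsum : (∑ j ∈ weilPrimeIndex a, |(χ (j : ZMod q)).re| *
        ((Λ j : ℝ) / Real.sqrt j * (2 * Real.cos (π / (⌊2 * a / Real.log j⌋₊ + 2))))) =
      ∑ j ∈ Finset.range ks.length, |((εs.getD j 0 : ℤ) : ℝ)| *
        ((ks.getD j default).wt * (2 * Real.cos (π / ((ns.getD j 0 : ℕ) + 2)))) := by
    have e1 : (∑ j ∈ weilPrimeIndex a, |(χ (j : ZMod q)).re| *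
        ((Λ j : ℝ) / Real.sqrt j * (2 * Real.cos (π / (⌊2 * a / Real.log j⌋₊ + 2))))) =
        ∑ j ∈ weilPrimeIndex a, (Λ j : ℝ) / Real.sqrt j *
          (|(χ (j : ZMod q)).re| * (2 * Real.cos (π / (⌊2 * a / Real.log j⌋₊ + 2)))) :=
      Finset.sum_congr rfl fun j _ ↦ by ring
    rw [e1, sum_weilPrimeIndex_eq_listSum hks (fun j ↦ |(χ (j : ZMod q)).re| * (2 * Real.cos (π / (⌊2 * a / Real.log j⌋₊ + 2)))),
      list_sum_map_eq_sum_range]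
    refine Finset.sum_congr rfl fun j hj ↦ ?_
    have hj' := Finset.mem_range.mp hj
    rw [PrimeLen.log_val, TwistedEncl.floor_eq_of_checkFloors hS ha0 hks hC hfl hj', hε j hj']
    ring
  rw [hsum]
  unfold aopBoxW at h
  rw [hC.wts_len] at h
  exact mem_aopSumW hS hC ns εs ks.length le_rfl h

/-! ## The sign facts with a generic prime constant -/

/-- ★ **The door's even-sector sign facts from checked boxes, GENERIC prime constant `Aop`** (verbatim `signsE_of_checkSignsE` with the real `A_op⁺(a)` replaced by any real `Aop ∈ d.AOP` — used with `Aop = A_χ(a)` for the character-weighted door `weilPositivityOnChar_of_twisted_formatC_dataAW`). Original docstring:: `checkSignsE = true`, valid constants / table below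
`N > B₃` / boxes `LQ ∋ log q`, `CC ∋ a(1 + weilArchDensity(2a))`, `AOP ∋ A_op⁺(a)` ⇒ `h0e`, `hd0e`, `hwe` of
`weilPositivityOnChar_of_twisted_formatC_data` with `d₀ = d0N·2^{−wbits}`, `w_m = wN_{m−B}·2^{−wbits}`.
[cite: Yoshida1992HermitianForms, §7 pp. 305–312] -/
theorem signsE_of_checkSignsE_A (hS : 0 < S) (ha0 : 0 < a) {ks : List PrimeLen} {C : Consts}
    (hC : ConstsValid S a ks C) {LQ : MI} (hLQ : MI.mem S (Real.log q) LQ) {N : ℕ} {tab : List IdxRec}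
    (hT : TabValid S a ks N tab) {d : EvenCellData} (hN : d.B3 < N)
    (hCC : MI.mem S (a * (1 + weilArchDensity (2 * a))) d.CC)
    {Aop : ℝ} (hAOP : MI.mem S Aop d.AOP)
    (h : checkSignsE S C LQ tab d = true) :
    (0 < ((reDigammaQuarter (freq a d.B) - Real.log π + Real.log q) / 2 - a * (1 + weilArchDensity (2 * a)) / (π ^ 2 * d.B ^ 2) - 1 / (8 * d.B) - a * (1 + weilArchDensity (2 * a)) / π ^ 2 * Real.sqrt (8 / ((d.B - 1 : ℕ) : ℝ)) - Aop / 2)) ∧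
    (0 < (d.d0N : ℝ) / 2 ^ d.wbits ∧ (d.d0N : ℝ) / 2 ^ d.wbits ≤ ((reDigammaQuarter (freq a d.B3) - Real.log π + Real.log q) / 2 - a * (1 + weilArchDensity (2 * a)) / (π ^ 2 * d.B3 ^ 2) - 1 / (8 * d.B3) - a * (1 + weilArchDensity (2 * a)) / π ^ 2 * Real.sqrt (8 / ((d.B - 1 : ℕ) : ℝ)) - Aop / 2)) ∧
    (∀ m, d.B ≤ m → m < d.B3 → 0 < (d.wN.getD (m - d.B) 0 : ℝ) / 2 ^ d.wbits ∧ (d.wN.getD (m - d.B) 0 : ℝ) / 2 ^ d.wbits ≤ ((reDigammaQuarter (freq a m) - Real.log π + Real.log q) / 2 - a * (1 + weilArchDensity (2 * a)) / (π ^ 2 * m ^ 2) - 1 / (8 * m) - a * (1 + weilArchDensity (2 * a)) / π ^ 2 * Real.sqrt (8 / ((d.B - 1 : ℕ) : ℝ)) - Aop / 2)) := by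
  unfold checkSignsE at h
  simp only [Bool.and_eq_true, decide_eq_true_eq, List.all_eq_true, List.mem_range] at h
  obtain ⟨⟨⟨⟨⟨⟨⟨hB2, hBB3⟩, hr8D⟩, hd0N⟩, hr8⟩, h0⟩, hd0⟩, hw⟩ := h
  set Cc := a * (1 + weilArchDensity (2 * a)) with hCc
  have hCc0 : 0 ≤ Cc := by
    have hE : 0 < weilArchDensity (2 * a) := weilArchDensity_pos (by positivity)
    positivity
  -- `√(8/(B−1)) ≤ r₈`
  have hr8' : Real.sqrt (8 / ((d.B - 1 : ℕ) : ℝ)) ≤ (d.r8N : ℝ) / d.r8D := by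
    have hB1 : (0 : ℝ) < ((d.B - 1 : ℕ) : ℝ) := by exact_mod_cast (show 0 < d.B - 1 by omega)
    have hrD : (0 : ℝ) < d.r8D := by exact_mod_cast hr8D
    have hq : (8 : ℝ) / ((d.B - 1 : ℕ) : ℝ) ≤ ((d.r8N : ℝ) / d.r8D) ^ 2 := by
      have h' : (8 : ℝ) * (d.r8D : ℝ) ^ 2 ≤ ((d.B - 1 : ℕ) : ℝ) * (d.r8N : ℝ) ^ 2 := by exact_mod_cast hr8
      rw [div_pow, div_le_div_iff₀ hB1 (by positivity)]
      linarith
    calc Real.sqrt (8 / ((d.B - 1 : ℕ) : ℝ)) ≤ Real.sqrt (((d.r8N : ℝ) / d.r8D) ^ 2) := Real.sqrt_le_sqrt hq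
      _ = (d.r8N : ℝ) / d.r8D := Real.sqrt_sq (by positivity)
  have hSr : (0 : ℝ) < S := by exact_mod_cast hS
  -- generic step: box at m
  have step : ∀ m, 1 ≤ m → m < N →
      ((dhatEBox S C LQ tab d m).lo : ℝ) ≤ S * ((reDigammaQuarter (freq a m) - Real.log π + Real.log q) / 2 -
        Cc / (π ^ 2 * m ^ 2) - 1 / (8 * m) - Cc / π ^ 2 * Real.sqrt (8 / ((d.B - 1 : ℕ) : ℝ)) - Aop / 2) := by
    intro m hm1 hmN
    have hmem := mem_dhatEBox hS hC hLQ hT hCC hAOP hr8D hm1 hmN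
    have hle := dhatELow_le (a := a) (Lq := Real.log q) (Aop := Aop) hCc0 hr8' m
    have := hmem.1
    nlinarith
  refine ⟨?_, ⟨by positivity, ?_⟩, fun m hBm hmB3 ↦ ⟨?_, ?_⟩⟩
  · have h1 := step d.B (by omega) (by omega)
    have h0' : (0 : ℝ) < (dhatEBox S C LQ tab d d.B).lo := by exact_mod_cast h0
    have h3 := lt_of_lt_of_le h0' h1
    rcases pos_and_pos_or_neg_and_neg_of_mul_pos h3 with ⟨_, h⟩ | ⟨h, _⟩
    · exact h
    · exact absurd h (not_lt.2 hSr.le)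
  · have h1 := step d.B3 (by omega) hN
    have hd0' : ((d.d0N : ℤ) : ℝ) * S ≤ ((dhatEBox S C LQ tab d d.B3).lo : ℝ) * 2 ^ d.wbits := by exact_mod_cast hd0
    have h2 : (0 : ℝ) < 2 ^ d.wbits := by positivity
    rw [div_le_iff₀ h2]
    push_cast at hd0'
    nlinarith
  · have := (hw (m - d.B) (by omega)).1
    positivity
  · have h1 := step m (by omega) (by omega)
    have hw' := (hw (m - d.B) (by omega)).2
    rw [show d.B + (m - d.B) = m by omega] at hw'
    have hw'' : ((d.wN.getD (m - d.B) 0 : ℤ) : ℝ) * S ≤ ((dhatEBox S C LQ tab d m).lo : ℝ) * 2 ^ d.wbits := by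
      exact_mod_cast hw'
    have h2 : (0 : ℝ) < 2 ^ d.wbits := by positivity
    rw [div_le_iff₀ h2]
    push_cast at hw''
    nlinarith

/-- ★ **The door's odd-sector sign facts, sharp column weights, GENERIC prime constant `Aop`** (verbatim `signsO_of_checkSignsOA` with `A_op⁺(a)` replaced by any real `Aop ∈ d.AOP`). Original docstring: — literally the conclusion of
`signsO_of_checkSignsO` (`h0o`, `hd0o`, `hwo` of the twisted format-C data doors with `d0o = d0N·2^{−wbits}`,
`wo l = wN_{l−B}·2^{−wbits}`), from `checkSignsOA`. [cite: Yoshida1992HermitianForms, §7 pp. 305–312] -/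
theorem signsO_of_checkSignsOA_A (hS : 0 < S) (ha0 : 0 < a) {ks : List PrimeLen} {C : Consts}
    (hC : ConstsValid S a ks C) {LQ : MI} (hLQ : MI.mem S (Real.log q) LQ) {N : ℕ} {tab : List IdxRec}
    (hT : TabValid S a ks N tab) {d : OddCellData} (hN : d.B3 + 1 < N)
    (hCC : MI.mem S (a * (1 + weilArchDensity (2 * a))) d.CC)
    {Aop : ℝ} (hAOP : MI.mem S Aop d.AOP)
    {Karc : ℕ} (h : checkSignsOA S Karc C LQ tab d = true) :
    (0 < ((reDigammaQuarter (freq a ((d.B : ℤ) + 1)) - Real.log π + Real.log q) / 2 - 1 / (8 * ((d.B : ℝ) + 1)) - a * (1 + weilArchDensity (2 * a)) / (π ^ 2 * ((d.B : ℝ) + 1) ^ 2)) - π / 4 - a * (1 + weilArchDensity (2 * a)) / π ^ 2 * Real.sqrt (8 / d.B) - Aop / 2) ∧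
    (0 < (d.d0N : ℝ) / 2 ^ d.wbits ∧ (d.d0N : ℝ) / 2 ^ d.wbits ≤ ((reDigammaQuarter (freq a ((d.B3 : ℤ) + 1)) - Real.log π + Real.log q) / 2 - 1 / (8 * ((d.B3 : ℝ) + 1)) - a * (1 + weilArchDensity (2 * a)) / (π ^ 2 * ((d.B3 : ℝ) + 1) ^ 2)) - π / 4 - a * (1 + weilArchDensity (2 * a)) / π ^ 2 * Real.sqrt (8 / d.B) - Aop / 2) ∧
    (∀ l, d.B ≤ l → l < d.B3 → 0 < (d.wN.getD (l - d.B) 0 : ℝ) / 2 ^ d.wbits ∧ (d.wN.getD (l - d.B) 0 : ℝ) / 2 ^ d.wbits ≤ ((reDigammaQuarter (freq a ((l : ℤ) + 1)) - Real.log π + Real.log q) / 2 - 1 / (8 * ((l : ℝ) + 1)) - a * (1 + weilArchDensity (2 * a)) / (π ^ 2 * ((l : ℝ) + 1) ^ 2) - (π / 2 - Real.arctan (Real.sqrt d.B / Real.sqrt ((l : ℝ) + 1))) / 2 - a * (1 + weilArchDensity (2 * a)) / π ^ 2 * Real.sqrt (8 / d.B) - Aop / 2)) := by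
  unfold checkSignsOA at h
  simp only [Bool.and_eq_true, decide_eq_true_eq, List.all_eq_true, List.mem_range] at h
  obtain ⟨⟨⟨⟨⟨⟨⟨hB1, hBB3⟩, hr8D⟩, hd0N⟩, hr8⟩, h0⟩, hd0⟩, hw⟩ := h
  -- the crude checker's conclusions for `h0o`, `hd0o` (same tests): re-assemble a `checkSignsO`-free argument
  set Cc := a * (1 + weilArchDensity (2 * a)) with hCc
  have hCc0 : 0 ≤ Cc := by
    have hE : 0 < weilArchDensity (2 * a) := weilArchDensity_pos (by positivity)
    positivity
  have hπ2 : 0 < π ^ 2 := by positivity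
  have hr8' : Real.sqrt (8 / (d.B : ℝ)) ≤ (d.r8N : ℝ) / d.r8D := by
    have hB0 : (0 : ℝ) < d.B := by exact_mod_cast (show 0 < d.B by omega)
    have hrD : (0 : ℝ) < d.r8D := by exact_mod_cast hr8D
    have hq : (8 : ℝ) / (d.B : ℝ) ≤ ((d.r8N : ℝ) / d.r8D) ^ 2 := by
      have h' : (8 : ℝ) * (d.r8D : ℝ) ^ 2 ≤ (d.B : ℝ) * (d.r8N : ℝ) ^ 2 := by exact_mod_cast hr8
      rw [div_pow, div_le_div_iff₀ hB0 (by positivity)]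
      linarith
    calc Real.sqrt (8 / (d.B : ℝ)) ≤ Real.sqrt (((d.r8N : ℝ) / d.r8D) ^ 2) := Real.sqrt_le_sqrt hq
      _ = (d.r8N : ℝ) / d.r8D := Real.sqrt_sq (by positivity)
  have hSr : (0 : ℝ) < S := by exact_mod_cast hS
  have step : ∀ l, l + 1 < N →
      ((dhatOBox S C LQ tab d l).lo : ℝ) ≤ S * ((reDigammaQuarter (freq a ((l : ℤ) + 1)) - Real.log π + Real.log q) / 2 -
        1 / (8 * ((l : ℝ) + 1)) - Cc / (π ^ 2 * ((l : ℝ) + 1) ^ 2) - π / 4 - Cc / π ^ 2 * Real.sqrt (8 / d.B) - Aop / 2) := by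
    intro l hl
    have hmem := (mem_dhatOBox hS hC hLQ hT hCC hAOP hr8D hl).1
    unfold dhatOLow at hmem
    have h1 : Cc / π ^ 2 * Real.sqrt (8 / (d.B : ℝ)) ≤ Cc / π ^ 2 * ((d.r8N : ℝ) / d.r8D) :=
      mul_le_mul_of_nonneg_left hr8' (div_nonneg hCc0 hπ2.le)
    have h2 : Cc / π ^ 2 / (((l : ℝ) + 1) * ((l : ℝ) + 1)) = Cc / (π ^ 2 * ((l : ℝ) + 1) ^ 2) := by rw [div_div]; ring
    rw [h2] at hmem
    nlinarith
  have stepA : ∀ l, l + 1 < N → ∀ Z : MI, dhatOBoxA S Karc C LQ tab d l = some Z →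
      ((Z.lo : ℝ)) ≤ S * ((reDigammaQuarter (freq a ((l : ℤ) + 1)) - Real.log π + Real.log q) / 2 -
        1 / (8 * ((l : ℝ) + 1)) - Cc / (π ^ 2 * ((l : ℝ) + 1) ^ 2)
        - (π / 2 - Real.arctan (Real.sqrt d.B / Real.sqrt ((l : ℝ) + 1))) / 2 - Cc / π ^ 2 * Real.sqrt (8 / d.B) - Aop / 2) := by
    intro l hl Z hZ
    have hmem := (mem_dhatOBoxA hS hC hLQ hT hCC hAOP hr8D hl hZ).1
    unfold dhatOLow at hmem
    have h1 : Cc / π ^ 2 * Real.sqrt (8 / (d.B : ℝ)) ≤ Cc / π ^ 2 * ((d.r8N : ℝ) / d.r8D) :=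
      mul_le_mul_of_nonneg_left hr8' (div_nonneg hCc0 hπ2.le)
    have h2 : Cc / π ^ 2 / (((l : ℝ) + 1) * ((l : ℝ) + 1)) = Cc / (π ^ 2 * ((l : ℝ) + 1) ^ 2) := by rw [div_div]; ring
    rw [h2] at hmem
    nlinarith
  refine ⟨?_, ⟨by positivity, ?_⟩, fun l hBl hlB3 ↦ ⟨?_, ?_⟩⟩
  · have h1 := step d.B (by omega)
    have h0' : (0 : ℝ) < (dhatOBox S C LQ tab d d.B).lo := by exact_mod_cast h0
    have h3 := lt_of_lt_of_le h0' h1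
    rcases pos_and_pos_or_neg_and_neg_of_mul_pos h3 with ⟨_, h⟩ | ⟨h, _⟩
    · linarith
    · exact absurd h (not_lt.2 hSr.le)
  · have h1 := step d.B3 (by omega)
    have hd0' : ((d.d0N : ℤ) : ℝ) * S ≤ ((dhatOBox S C LQ tab d d.B3).lo : ℝ) * 2 ^ d.wbits := by exact_mod_cast hd0
    have h2 : (0 : ℝ) < 2 ^ d.wbits := by positivity
    rw [div_le_iff₀ h2]
    push_cast at hd0' h1 ⊢
    nlinarith
  · have := (hw (l - d.B) (by omega)).1
    positivity
  · have hw' := (hw (l - d.B) (by omega)).2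
    rw [show d.B + (l - d.B) = l by omega] at hw'
    split at hw'
    · rename_i Z hZ
      simp only [decide_eq_true_eq] at hw'
      have h1 := stepA l (by omega) Z hZ
      have hw'' : ((d.wN.getD (l - d.B) 0 : ℤ) : ℝ) * S ≤ ((Z.lo : ℤ) : ℝ) * 2 ^ d.wbits := by exact_mod_cast hw'
      have h2 : (0 : ℝ) < 2 ^ d.wbits := by positivity
      rw [div_le_iff₀ h2]
      push_cast at hw'' h1 ⊢
      nlinarith
    · simp at hw'

end TwistedEncl

end Summit.Ventures.WeilGRH
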